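/-
Origin: expansion seat `planner-pub-hodgecm-pv09-g7-0`, handover #2 2026-08-18T12:57:59Z (md5 63b112d55e7ed747ef1278ddcc39adfc; NEW additive leaf; THREE import rewrites by the generic ^import Pv[0-9]+g[0-9]+\. -> import HodgeCM.PerL34. rule: Pv09g7.RestrictedTensorFunctor (my #1), Pv09g6.GenuineTensorEnd (RUN 29 row 0182baea, installed), Pv07g5.GenuineTransfer (pv07-g5 RUN-30 #1 dfc65055); land AFTER all three; HOLD iff #1 or GenuineTransfer is held) (`HOME/pub-hodgecm-pv09-g7/lean/Pv09g7/GenuineTensorEmbed.lean`, md5 63b112d5, 405 lines);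
landed by the gen-8 packager in gate run 30 as `HodgeCM/PerL34/GenuineTensorEmbed.lean` (import ^import Pv07g5\.GenuineTransfer[ \t]*$→import HodgeCM.PerL34.GenuineTransfer ×1; import ^import Pv09g7\.RestrictedTensorFunctor[ \t]*$→import HodgeCM.PerL34.RestrictedTensorFunctor ×1; import ^import Pv09g6\.GenuineTensorEnd[ \t]*$→import HodgeCM.PerL34.GenuineTensorEnd ×1).
-/
/-
Copyright: HodgeCM publication cell (pub-hodgecm), seam S3 (𝓕-side / genuine idelic torus end; the S3 END
for a datum whose space CONTAINS the `⊗′`-model through a kernel map).  Prover seat pub-hodgecm-pv09-g7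
(DAG-node prover #09, generation 7), file #2; intended final place `HodgeCM/PerL34/GenuineTensorEmbed.lean`.
WIP imports: `Pv09g7.RestrictedTensorFunctor` ↦ `HodgeCM.PerL34.RestrictedTensorFunctor` (this seat, #1),
`Pv09g6.GenuineTensorEnd` ↦ `HodgeCM.PerL34.GenuineTensorEnd` (pv09-g6 #4, RUN 29),
`Pv07g5.GenuineTransfer` ↦ `HodgeCM.PerL34.GenuineTransfer` (pv07-g5 #1, RUN 30).  Complete proofs, no new
axioms, nothing cited.  Released under the package licence.
-/
import Summits.HodgeConjecture.HodgeCM.PerL34.RestrictedTensorFunctor_2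
import Summits.HodgeConjecture.HodgeCM.PerL34.GenuineTensorEnd
import Summits.HodgeConjecture.HodgeCM.PerL34.GenuineTransfer

/-!
# The S3 END for any datum containing a kernel-map image of the `⊗′`-model

pv09-g6 #4 (`GenuineTensorEnd`) discharges the torus side of the S3 END for a doubling datum `D` on the space
`⊗′_i (H_i, e_i)` ITSELF, under the model EQUALITY `hω : D.ω = ⊗′ρ`.  pv07-g5 #1 (`GenuineTransfer`) moves every
torus-side binder along an isometric equivariant map `E : Sp₁ →ₗᵢ[ℂ] Sp`.  The universal property of `⊗′`
(pv13-g5 `RestrictedTensor.lift`, this seat's `RestrictedTensor.lift_rep`) produces such an `E` from nothing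
more than a KERNEL MAP: a function `Φ : RVec (unitFam L) → Sp` on restricted families with the Gram kernel
`⟪Φ x, Φ y⟫ = ∏_i ⟪x_i, y_i⟫` (`hΦ`) on whose values `D.ω` acts factor-wise, `D.ω g (Φ x) = Φ (i ↦ ρ_i(g_i) x_i)`
(`hπ`).  Composing the three:

* `Genuine.exists_compactDomain_thetaLift_ne_zero_genuine_tensor_of_kernelMap` — for EVERY CM field `L`, finite
  `S ⊇ T' ∪ {∞}`, character `χ` (level `K_{T'}`, local continuity on `T'`, trivial on `U(1)(L⁺)`), free local
  data `ν` (unramified at the split places off `S`, continuous at the split places), centres `x₀ ≠ 0` at the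
  split places of `S`, and ANY doubling datum `D` on ANY Hilbert space `Sp` (strongly continuous on the local
  groups, `hloc`) together with a kernel map `(Φ, hΦ, hπ)` into `Sp`: the END's conclusion for the vector
  `Φ (phiFam L S x₀ (radius …)) ∈ Sp` — the image of the distinguished restricted family `φ•_i`.
  No model equality, no embedding to supply: `hΦ` and `hπ` are identities between vectors of `Sp`.
* `…_of_kernelMap_total` — if the `Φ x` are TOTAL in `Sp` (`(Sp, D.ω|torus) ≅ (⊗′H, ⊗′ρ)` unitarily via
  `liftEquiv`), `hloc` is DISCHARGED as well (from pv09-g6 #2 `continuous_rep_mulSingle_apply`): no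
  representation-side hypothesis on the datum remains.
* `…_of_kernelMap_level` — the same with the bookkeeping `S := levelSet L T'` of pv09-g6 #4.
* `…_genuine_tensor_of_localIsometries` — the residual made LOCAL: for a datum on a restricted tensor product
  `⊗′_i (H'_i, e'_i)` of bigger local spaces with `D.ω = ⊗′ρ'`, per-place isometric embeddings `V_i : H_i →ₗᵢ H'_i`
  intertwining `ρ_i` with `ρ'_i` and mapping `e_i ↦ e'_i` a.a. give the END for `(⊗′V)(φ•)` (`tmap`, #1).
* `…_genuine_tensor_of_eq` — consistency: pv09-g6 #4's statement (`Sp = ⊗′H`, `hω : D.ω = ⊗′ρ`) re-derived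
  from `_of_kernelMap` with `Φ := tp` (so `_of_kernelMap` is a genuine generalisation of #4, not a variant).

For the Schrödinger model `L²(X)` the kernel map is `Φ x := ∏_v x_v` (pv13-g5 `RestrictedTensorL2`, `hΦ` =
Fubini on cylinders) and `hπ` is the factor-wise action of the model representation on product functions.

Honest limits: the binders that remain are the ambient ones (`D`, `GU`, `j, hj`, `P`, `hχVΓ`, `hloc` on `Sp` —
discharged when the kernel map is total —, finiteness of `GU.μ`), the character-side ones (`hχΓ, hχT', hlocχ`)
and the kernel map `(Φ, hΦ, hπ)`; producing the datum `D` (PerL's adelic theta MODEL, GAPS carverg2-X1) is not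
done here; nothing is cited; no PRINT item is touched.
-/

set_option autoImplicit false

noncomputable section

open MeasureTheory MeasureTheory.Measure Set Metric Function Complex ComplexConjugate Topology Filter
open scoped RestrictedProduct InnerProductSpace NNReal ENNReal

namespace HodgeCM.PerL34.RestrictedTensor.Genuine

open HodgeCM.PerL34.SplitShells HodgeCM.PerL34.AdelicFactorisation HodgeCM.PerL34.RestrictedMeasure
open HodgeCM.PerL34.NoSmallSubgroups HodgeCM.PerL34.EulerFactorisation HodgeCM.PerL34.DiscreteFD
open HodgeCM.PerL34.LocalFactors HodgeCM.PerL34.LocalFactors.DilationModel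
open HodgeCM.PerL34.LocalModulus HodgeCM.PerL34.SplitPlaceDilation
open HodgeCM.PerL34.RallisIP HodgeCM.PerL34.Doubling HodgeCM.PerL34.N31d NumberField IsDedekindDomain
open HodgeCM.PerL34.IdelePlaces HodgeCM.PerL34.RestrictedRegroup HodgeCM.PerL34.RestrictedCutout
open HodgeCM.PerL34.IdelicTorusModel HodgeCM.PerL34.IdelicTorusModel.Genuine HodgeCM.PerL34.PureTensor

attribute [local instance] LocalFactors.DilationModel.Adic.nontriviallyNormedField
  LocalFactors.DilationModel.Adic.properSpace

variable (L : Type) [Field L] [NumberField L] [IsCMField L]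

/-- the lift of a kernel map evaluated at the distinguished vector: `lift Φ (φ•) = Φ (φ•_i)_i`. -/
theorem lift_phi [DecidableEq (Place (maximalRealSubfield L))]
    [∀ v : HeightOneSpectrum (𝓞 (maximalRealSubfield L)), MeasurableSpace (v.adicCompletion (maximalRealSubfield L))]
    [∀ v : HeightOneSpectrum (𝓞 (maximalRealSubfield L)), BorelSpace (v.adicCompletion (maximalRealSubfield L))]
    {Sp : Type*} [NormedAddCommGroup Sp] [InnerProductSpace ℂ Sp] [CompleteSpace Sp]
    (Φ : RVec (unitFam L) → Sp) (hΦ : ∀ x y, ⟪Φ x, Φ y⟫_ℂ = kfun x y)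
    (S : Finset (Place (maximalRealSubfield L)))
    (x₀ : ∀ i : Place (maximalRealSubfield L), Fin 3 → (basePlaceOf L i).adicCompletion (maximalRealSubfield L))
    (r : Place (maximalRealSubfield L) → ℝ) :
    lift Φ hΦ (phi L S x₀ r) = Φ (phiFam L S x₀ r) :=
  lift_tp Φ hΦ _

set_option synthInstance.maxHeartbeats 200000 in
-- (as in the END theorem: the `SMul Γ (Model L)` instance behind `IsFundamentalDomain` is slow to find)
/-- **S3 END for any datum containing a kernel-map image of `⊗′_i (H_i, e_i)`.**  For a CM field `L`, a finite
set `S` of places of `L⁺` containing `T'` and the infinite places, a character `χ` of the model group of level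
`K_{T'}` (locally continuous on `T'`, trivial on `U(1)(L⁺)`), ANY family `ν_i` of continuous unitary characters
unramified at the split places off `S`, ANY centres `x₀_i ≠ 0` at the split places of `S`, ANY doubling datum
`D` on ANY Hilbert space `Sp` whose representation is strongly continuous on the local groups (`hloc`), and ANY
kernel map `Φ : RVec (unitFam L) → Sp` (`hΦ` : Gram kernel `∏_i ⟪x_i, y_i⟫`; `hπ` : `D.ω` acts factor-wise on
the `Φ x`): the END's conclusion for the vector `Φ (φ•_i)_i`, `φ•_i = phiFam L S x₀ (radius …) i`. -/
theorem exists_compactDomain_thetaLift_ne_zero_genuine_tensor_of_kernelMap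
    [DecidableEq (Place (maximalRealSubfield L))]
    [∀ v : HeightOneSpectrum (𝓞 (maximalRealSubfield L)), MeasurableSpace (v.adicCompletion (maximalRealSubfield L))]
    [∀ v : HeightOneSpectrum (𝓞 (maximalRealSubfield L)), BorelSpace (v.adicCompletion (maximalRealSubfield L))]
    (S₀ : Finset (Place (maximalRealSubfield L)))
    {Sp : Type} [NormedAddCommGroup Sp] [InnerProductSpace ℂ Sp] [CompleteSpace Sp]
    {W : Type} [AddCommGroup W] [Module L W]
    {H Sbox : Type} [Group H] [AddCommGroup Sbox] [Module ℂ Sbox]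
    {h : W →ₗ⋆[L] W →ₗ[L] L} (hW : IsLine L W) (hh : Anisotropic h)
    (D : DoublingDatum (Model L) H Sp Sbox) (GU : ThetaSide Sp Sbox)
    (j : isomBox h →* H) (hj : ∀ d : unitary L, j ⟨iotaSnd d, iotaSnd_mem h d⟩ = D.ι (1, unitaryToModel L d))
    (χ : Model L →* Circle) (hχΓ : ∀ d : unitary L, χ (unitaryToModel L d) = 1)
    (hχVΓ : ∀ d : unitary L, D.χV (unitaryToModel L d) = 1)
    {hP : ∀ Ψ : Sbox, ∀ p ∈ (stabDelta L W).subgroupOf (isomBox h), ∀ x : H, D.fSW Ψ (j p * x) = D.fSW Ψ x}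
    (P : GluePrintInputs D GU h j hP)
    (hloc : ∀ (i : Place (maximalRealSubfield L)) (v : Sp),
      Continuous fun g : locTorus (maximalRealSubfield L) L i => D.ω (RestrictedProduct.mulSingle (genLevel L) i g) v)
    {T' : Finset (Place (maximalRealSubfield L))}
    (hχT' : RestrictedProduct.boxSubgroup (genLevel L) T' ≤ χ.ker)
    (hlocχ : ∀ i ∈ T', Continuous fun g : locTorus (maximalRealSubfield L) L i =>
      χ (RestrictedProduct.mulSingle (genLevel L) i g))
    {S : Finset (Place (maximalRealSubfield L))} (hT'S : T' ⊆ S)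
    (hS : ∀ v : InfinitePlace (maximalRealSubfield L), Sum.inl v ∈ S)
    {ν : ∀ i : Place (maximalRealSubfield L),
      ((basePlaceOf L i).adicCompletion (maximalRealSubfield L))ˣ →* Circle}
    (hν : ∀ i, i ∉ S → IsSplitPlace L i →
      ∀ u : ((basePlaceOf L i).adicCompletion (maximalRealSubfield L))ˣ,
        ‖(u : (basePlaceOf L i).adicCompletion (maximalRealSubfield L))‖ = 1 → ν i u = 1)
    (hνc : ∀ i, IsSplitPlace L i → Continuous (ν i))
    (x₀ : ∀ i : Place (maximalRealSubfield L), Fin 3 → (basePlaceOf L i).adicCompletion (maximalRealSubfield L))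
    (hx₀ : ∀ i ∈ S, IsSplitPlace L i → x₀ i ≠ 0)
    (Φ : RVec (unitFam L) → Sp) (hΦ : ∀ x y, ⟪Φ x, Φ y⟫_ℂ = kfun x y)
    (hπ : ∀ (g : Model L) (x : RVec (unitFam L)), D.ω g (Φ x) = Φ (gact (admissible L hν hχT') g x))
    [IsFiniteMeasure GU.μ] :
    ∃ 𝓕 : Set (Model L), IsCompact 𝓕 ∧ (interior 𝓕).Nonempty ∧ MeasurableSet 𝓕 ∧
      IsFundamentalDomain (unitaryToModel L).range 𝓕
        (haarDatum (genLevel L) (isCompact_genLevel L) (isOpen_genLevel L) S₀).μ ∧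
      (haarDatum (genLevel L) (isCompact_genLevel L) (isOpen_genLevel L) S₀).μ 𝓕 ≠ 0 ∧
      (haarDatum (genLevel L) (isCompact_genLevel L) (isOpen_genLevel L) S₀).μ 𝓕 ≠ ⊤ ∧
      ∀ [IsFiniteMeasure (((haarDatum (genLevel L) (isCompact_genLevel L) (isOpen_genLevel L) S₀).μ).restrict 𝓕)]
        (hk : Measurable (Function.uncurry
          (thetaFn D GU (Φ (phiFam L S x₀ (radius L S hνc hχT' hlocχ x₀ hx₀)))))) {Ck : ℝ} (hCk : 0 ≤ Ck)
        (hkC : ∀ q u, ‖thetaFn D GU (Φ (phiFam L S x₀ (radius L S hνc hχT' hlocχ x₀ hx₀))) q u‖ ≤ Ck),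
        PeterssonFubini.theta GU.μ
          (((haarDatum (genLevel L) (isCompact_genLevel L) (isOpen_genLevel L) S₀).μ).restrict 𝓕) hk
          (measurable_coe_char (genLevel L) (isOpen_genLevel L) χ hχT' hlocχ) hCk hkC (norm_coe_char_le χ) ≠ 0 := by
  have hr0 : ∀ i ∈ S, IsSplitPlace L i → 0 < radius L S hνc hχT' hlocχ x₀ hx₀ i :=
    fun i hi hs => (radius_spec L S hνc hχT' hlocχ x₀ hx₀ i hi hs).1
  have hK₁ : ∀ k ∈ RestrictedProduct.boxSubgroup (genLevel L) (S ∪ T'),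
      rep (admissible L hν hχT') k (phi L S x₀ (radius L S hνc hχT' hlocχ x₀ hx₀)) =
        phi L S x₀ (radius L S hνc hχT' hlocχ x₀ hx₀) :=
    fun k hk => rep_phi_eq_self L S x₀ _ hν hχT' hk
  have hM₁ : ∀ S' : Finset (Place (maximalRealSubfield L)), S ∪ T' ⊆ S' →
      ∀ y : (i : ↥S') → locTorus (maximalRealSubfield L) L i,
        inner ℂ (phi L S x₀ (radius L S hνc hχT' hlocχ x₀ hx₀))
            (rep (admissible L hν hχT') (extendOne (genLevel L) S' y)
              (phi L S x₀ (radius L S hνc hχT' hlocχ x₀ hx₀))) =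
          ∏ i : ↥S', localCoeff (genLevel L) (rep (admissible L hν hχT'))
            (phi L S x₀ (radius L S hνc hχT' hlocχ x₀ hx₀)) i (y i) :=
    fun S' _ y => inner_phi_rep_extendOne L S x₀ hν hχT' hr0 S' y
  have hE : ∀ (g : Model L) (v : Space (unitFam L)),
      lift Φ hΦ (rep (admissible L hν hχT') g v) = D.ω g (lift Φ hΦ v) :=
    fun g v => lift_rep (admissible L hν hχT') Φ hΦ D.ω hπ g v
  have h := exists_compactDomain_thetaLift_ne_zero_genuine_of_embedding L S₀ hW hh D GU j hj χ hχΓ hχVΓ P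
    hloc hχT' hlocχ (rep (admissible L hν hχT')) (phi L S x₀ (radius L S hνc hχT' hlocχ x₀ hx₀))
    (norm_phi L S x₀ hr0) hK₁ hM₁ (Finset.union_subset subset_rfl hT'S) hT'S hS
    (thetaInputOfData L S hν hνc hχT' hlocχ x₀ hx₀) (lift Φ hΦ) hE
  rwa [lift_phi] at h

set_option synthInstance.maxHeartbeats 200000 in
/-- **… with a TOTAL kernel map: `hloc` is discharged too.**  If moreover the vectors `Φ x` span a dense subspace
of `Sp` (`hd`) — i.e. `(Sp, D.ω|torus)` is unitarily equivalent to `(⊗′H, ⊗′ρ)` through `liftEquiv Φ` (#1) — then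
the strong continuity of `D.ω` on the local groups FOLLOWS from that of `⊗′ρ` (pv09-g6 #2
`continuous_rep_mulSingle_apply`) and the END holds with NO representation-side hypothesis on the datum at all:
the binders left are the theta/doubling side (`D`, `GU`, `j, hj`, `P`, `hχVΓ`, `GU.μ` finite), the character side
(`hχΓ, hχT', hlocχ`), the free local data (`ν`, `x₀`) and the kernel map `(Φ, hΦ, hπ, hd)`. -/
theorem exists_compactDomain_thetaLift_ne_zero_genuine_tensor_of_kernelMap_total
    [DecidableEq (Place (maximalRealSubfield L))]
    [∀ v : HeightOneSpectrum (𝓞 (maximalRealSubfield L)), MeasurableSpace (v.adicCompletion (maximalRealSubfield L))]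
    [∀ v : HeightOneSpectrum (𝓞 (maximalRealSubfield L)), BorelSpace (v.adicCompletion (maximalRealSubfield L))]
    (S₀ : Finset (Place (maximalRealSubfield L)))
    {Sp : Type} [NormedAddCommGroup Sp] [InnerProductSpace ℂ Sp] [CompleteSpace Sp]
    {W : Type} [AddCommGroup W] [Module L W]
    {H Sbox : Type} [Group H] [AddCommGroup Sbox] [Module ℂ Sbox]
    {h : W →ₗ⋆[L] W →ₗ[L] L} (hW : IsLine L W) (hh : Anisotropic h)
    (D : DoublingDatum (Model L) H Sp Sbox) (GU : ThetaSide Sp Sbox)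
    (j : isomBox h →* H) (hj : ∀ d : unitary L, j ⟨iotaSnd d, iotaSnd_mem h d⟩ = D.ι (1, unitaryToModel L d))
    (χ : Model L →* Circle) (hχΓ : ∀ d : unitary L, χ (unitaryToModel L d) = 1)
    (hχVΓ : ∀ d : unitary L, D.χV (unitaryToModel L d) = 1)
    {hP : ∀ Ψ : Sbox, ∀ p ∈ (stabDelta L W).subgroupOf (isomBox h), ∀ x : H, D.fSW Ψ (j p * x) = D.fSW Ψ x}
    (P : GluePrintInputs D GU h j hP)
    {T' : Finset (Place (maximalRealSubfield L))}
    (hχT' : RestrictedProduct.boxSubgroup (genLevel L) T' ≤ χ.ker)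
    (hlocχ : ∀ i ∈ T', Continuous fun g : locTorus (maximalRealSubfield L) L i =>
      χ (RestrictedProduct.mulSingle (genLevel L) i g))
    {S : Finset (Place (maximalRealSubfield L))} (hT'S : T' ⊆ S)
    (hS : ∀ v : InfinitePlace (maximalRealSubfield L), Sum.inl v ∈ S)
    {ν : ∀ i : Place (maximalRealSubfield L),
      ((basePlaceOf L i).adicCompletion (maximalRealSubfield L))ˣ →* Circle}
    (hν : ∀ i, i ∉ S → IsSplitPlace L i →
      ∀ u : ((basePlaceOf L i).adicCompletion (maximalRealSubfield L))ˣ,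
        ‖(u : (basePlaceOf L i).adicCompletion (maximalRealSubfield L))‖ = 1 → ν i u = 1)
    (hνc : ∀ i, IsSplitPlace L i → Continuous (ν i))
    (x₀ : ∀ i : Place (maximalRealSubfield L), Fin 3 → (basePlaceOf L i).adicCompletion (maximalRealSubfield L))
    (hx₀ : ∀ i ∈ S, IsSplitPlace L i → x₀ i ≠ 0)
    (Φ : RVec (unitFam L) → Sp) (hΦ : ∀ x y, ⟪Φ x, Φ y⟫_ℂ = kfun x y)
    (hπ : ∀ (g : Model L) (x : RVec (unitFam L)), D.ω g (Φ x) = Φ (gact (admissible L hν hχT') g x))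
    (hd : Dense ((Submodule.span ℂ (Set.range Φ) : Submodule ℂ Sp) : Set Sp))
    [IsFiniteMeasure GU.μ] :
    ∃ 𝓕 : Set (Model L), IsCompact 𝓕 ∧ (interior 𝓕).Nonempty ∧ MeasurableSet 𝓕 ∧
      IsFundamentalDomain (unitaryToModel L).range 𝓕
        (haarDatum (genLevel L) (isCompact_genLevel L) (isOpen_genLevel L) S₀).μ ∧
      (haarDatum (genLevel L) (isCompact_genLevel L) (isOpen_genLevel L) S₀).μ 𝓕 ≠ 0 ∧
      (haarDatum (genLevel L) (isCompact_genLevel L) (isOpen_genLevel L) S₀).μ 𝓕 ≠ ⊤ ∧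
      ∀ [IsFiniteMeasure (((haarDatum (genLevel L) (isCompact_genLevel L) (isOpen_genLevel L) S₀).μ).restrict 𝓕)]
        (hk : Measurable (Function.uncurry
          (thetaFn D GU (Φ (phiFam L S x₀ (radius L S hνc hχT' hlocχ x₀ hx₀)))))) {Ck : ℝ} (hCk : 0 ≤ Ck)
        (hkC : ∀ q u, ‖thetaFn D GU (Φ (phiFam L S x₀ (radius L S hνc hχT' hlocχ x₀ hx₀))) q u‖ ≤ Ck),
        PeterssonFubini.theta GU.μ
          (((haarDatum (genLevel L) (isCompact_genLevel L) (isOpen_genLevel L) S₀).μ).restrict 𝓕) hk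
          (measurable_coe_char (genLevel L) (isOpen_genLevel L) χ hχT' hlocχ) hCk hkC (norm_coe_char_le χ) ≠ 0 := by
  have hE : ∀ (g : Model L) (v : Space (unitFam L)),
      lift Φ hΦ (rep (admissible L hν hχT') g v) = D.ω g (lift Φ hΦ v) :=
    fun g v => lift_rep (admissible L hν hχT') Φ hΦ D.ω hπ g v
  have hloc : ∀ (i : Place (maximalRealSubfield L)) (v : Sp),
      Continuous fun g : locTorus (maximalRealSubfield L) L i =>
        D.ω (RestrictedProduct.mulSingle (genLevel L) i g) v := by
    intro i v
    obtain ⟨z, rfl⟩ := surjective_lift Φ hΦ hd v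
    have hfun : (fun g : locTorus (maximalRealSubfield L) L i =>
        D.ω (RestrictedProduct.mulSingle (genLevel L) i g) (lift Φ hΦ z)) =
        fun g => lift Φ hΦ (rep (admissible L hν hχT') (RestrictedProduct.mulSingle (genLevel L) i g) z) :=
      funext fun g => (hE _ z).symm
    rw [hfun]
    exact (lift Φ hΦ).continuous.comp (continuous_rep_mulSingle_apply L S hν hχT' hνc hlocχ i z)
  exact exists_compactDomain_thetaLift_ne_zero_genuine_tensor_of_kernelMap L S₀ hW hh D GU j hj χ hχΓ hχVΓ P hloc
    hχT' hlocχ hT'S hS hν hνc x₀ hx₀ Φ hΦ hπ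

set_option synthInstance.maxHeartbeats 200000 in
/-- **The same with `S := levelSet L T'`** (`T'` together with the infinite places: the bookkeeping
`T' ⊆ S ∋ ∞` removed, as in pv09-g6 #4 `…_tensor_level`). -/
theorem exists_compactDomain_thetaLift_ne_zero_genuine_tensor_of_kernelMap_level
    [DecidableEq (Place (maximalRealSubfield L))]
    [∀ v : HeightOneSpectrum (𝓞 (maximalRealSubfield L)), MeasurableSpace (v.adicCompletion (maximalRealSubfield L))]
    [∀ v : HeightOneSpectrum (𝓞 (maximalRealSubfield L)), BorelSpace (v.adicCompletion (maximalRealSubfield L))]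
    (S₀ : Finset (Place (maximalRealSubfield L)))
    {Sp : Type} [NormedAddCommGroup Sp] [InnerProductSpace ℂ Sp] [CompleteSpace Sp]
    {W : Type} [AddCommGroup W] [Module L W]
    {H Sbox : Type} [Group H] [AddCommGroup Sbox] [Module ℂ Sbox]
    {h : W →ₗ⋆[L] W →ₗ[L] L} (hW : IsLine L W) (hh : Anisotropic h)
    (D : DoublingDatum (Model L) H Sp Sbox) (GU : ThetaSide Sp Sbox)
    (j : isomBox h →* H) (hj : ∀ d : unitary L, j ⟨iotaSnd d, iotaSnd_mem h d⟩ = D.ι (1, unitaryToModel L d))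
    (χ : Model L →* Circle) (hχΓ : ∀ d : unitary L, χ (unitaryToModel L d) = 1)
    (hχVΓ : ∀ d : unitary L, D.χV (unitaryToModel L d) = 1)
    {hP : ∀ Ψ : Sbox, ∀ p ∈ (stabDelta L W).subgroupOf (isomBox h), ∀ x : H, D.fSW Ψ (j p * x) = D.fSW Ψ x}
    (P : GluePrintInputs D GU h j hP)
    (hloc : ∀ (i : Place (maximalRealSubfield L)) (v : Sp),
      Continuous fun g : locTorus (maximalRealSubfield L) L i => D.ω (RestrictedProduct.mulSingle (genLevel L) i g) v)
    {T' : Finset (Place (maximalRealSubfield L))}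
    (hχT' : RestrictedProduct.boxSubgroup (genLevel L) T' ≤ χ.ker)
    (hlocχ : ∀ i ∈ T', Continuous fun g : locTorus (maximalRealSubfield L) L i =>
      χ (RestrictedProduct.mulSingle (genLevel L) i g))
    {ν : ∀ i : Place (maximalRealSubfield L),
      ((basePlaceOf L i).adicCompletion (maximalRealSubfield L))ˣ →* Circle}
    (hν : ∀ i, i ∉ T' → IsSplitPlace L i →
      ∀ u : ((basePlaceOf L i).adicCompletion (maximalRealSubfield L))ˣ,
        ‖(u : (basePlaceOf L i).adicCompletion (maximalRealSubfield L))‖ = 1 → ν i u = 1)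
    (hνc : ∀ i, IsSplitPlace L i → Continuous (ν i))
    (x₀ : ∀ i : Place (maximalRealSubfield L), Fin 3 → (basePlaceOf L i).adicCompletion (maximalRealSubfield L))
    (hx₀ : ∀ i ∈ T', IsSplitPlace L i → x₀ i ≠ 0)
    (Φ : RVec (unitFam L) → Sp) (hΦ : ∀ x y, ⟪Φ x, Φ y⟫_ℂ = kfun x y)
    (hπ : ∀ (g : Model L) (x : RVec (unitFam L)),
      D.ω g (Φ x) = Φ (gact (admissible L (unram_levelSet L hν) hχT') g x))
    [IsFiniteMeasure GU.μ] :
    ∃ 𝓕 : Set (Model L), IsCompact 𝓕 ∧ (interior 𝓕).Nonempty ∧ MeasurableSet 𝓕 ∧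
      IsFundamentalDomain (unitaryToModel L).range 𝓕
        (haarDatum (genLevel L) (isCompact_genLevel L) (isOpen_genLevel L) S₀).μ ∧
      (haarDatum (genLevel L) (isCompact_genLevel L) (isOpen_genLevel L) S₀).μ 𝓕 ≠ 0 ∧
      (haarDatum (genLevel L) (isCompact_genLevel L) (isOpen_genLevel L) S₀).μ 𝓕 ≠ ⊤ ∧
      ∀ [IsFiniteMeasure (((haarDatum (genLevel L) (isCompact_genLevel L) (isOpen_genLevel L) S₀).μ).restrict 𝓕)]
        (hk : Measurable (Function.uncurry
          (thetaFn D GU (Φ (phiFam L (levelSet L T') x₀ (radius L (levelSet L T') hνc hχT' hlocχ x₀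
            (centre_levelSet L hx₀))))))) {Ck : ℝ} (hCk : 0 ≤ Ck)
        (hkC : ∀ q u, ‖thetaFn D GU (Φ (phiFam L (levelSet L T') x₀ (radius L (levelSet L T') hνc hχT' hlocχ x₀
            (centre_levelSet L hx₀)))) q u‖ ≤ Ck),
        PeterssonFubini.theta GU.μ
          (((haarDatum (genLevel L) (isCompact_genLevel L) (isOpen_genLevel L) S₀).μ).restrict 𝓕) hk
          (measurable_coe_char (genLevel L) (isOpen_genLevel L) χ hχT' hlocχ) hCk hkC (norm_coe_char_le χ) ≠ 0 :=
  exists_compactDomain_thetaLift_ne_zero_genuine_tensor_of_kernelMap L S₀ hW hh D GU j hj χ hχΓ hχVΓ P hloc hχT' hlocχ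
    (subset_levelSet L T') (inl_mem_levelSet L T') (unram_levelSet L hν) hνc x₀ (centre_levelSet L hx₀) Φ hΦ hπ

set_option synthInstance.maxHeartbeats 200000 in
/-- **S3 END for a datum on a restricted tensor product of BIGGER local spaces — the residual made LOCAL.**
For any unit family `𝓔' = (H'_i, e'_i)` over the places with admissible local representations `ρ'_i` of the
local tori, and any doubling datum `D` on `⊗′_i (H'_i, e'_i)` with `D.ω = ⊗′ρ'` (`hω`): if at EVERY place there is
an isometric embedding `V_i : H_i →ₗᵢ[ℂ] H'_i` of the genuine local model intertwining `ρ_i` with `ρ'_i`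
(`hint`) and mapping `e_i ↦ e'_i` for almost all `i` (`hV`), then the END's conclusion holds for the vector
`(⊗′V)(φ•) ∈ ⊗′H'` (`tmap V hV`, #1).  The kernel map is `x ↦ ⊗_i V_i x_i` (`kernel_tp_mapVec`, `mapVec_gact`). -/
theorem exists_compactDomain_thetaLift_ne_zero_genuine_tensor_of_localIsometries
    [DecidableEq (Place (maximalRealSubfield L))]
    [∀ v : HeightOneSpectrum (𝓞 (maximalRealSubfield L)), MeasurableSpace (v.adicCompletion (maximalRealSubfield L))]
    [∀ v : HeightOneSpectrum (𝓞 (maximalRealSubfield L)), BorelSpace (v.adicCompletion (maximalRealSubfield L))]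
    (S₀ : Finset (Place (maximalRealSubfield L)))
    {H' : Place (maximalRealSubfield L) → Type} [∀ i, NormedAddCommGroup (H' i)] [∀ i, InnerProductSpace ℂ (H' i)]
    {𝓔' : UnitFamily H'}
    {ρ' : ∀ i, locTorus (maximalRealSubfield L) L i →* (H' i ≃ₗᵢ[ℂ] H' i)} (hρ' : Admissible 𝓔' (genLevel L) ρ')
    {W : Type} [AddCommGroup W] [Module L W]
    {H Sbox : Type} [Group H] [AddCommGroup Sbox] [Module ℂ Sbox]
    {h : W →ₗ⋆[L] W →ₗ[L] L} (hW : IsLine L W) (hh : Anisotropic h)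
    (D : DoublingDatum (Model L) H (Space 𝓔') Sbox) (GU : ThetaSide (Space 𝓔') Sbox)
    (j : isomBox h →* H) (hj : ∀ d : unitary L, j ⟨iotaSnd d, iotaSnd_mem h d⟩ = D.ι (1, unitaryToModel L d))
    (χ : Model L →* Circle) (hχΓ : ∀ d : unitary L, χ (unitaryToModel L d) = 1)
    (hχVΓ : ∀ d : unitary L, D.χV (unitaryToModel L d) = 1)
    {hP : ∀ Ψ : Sbox, ∀ p ∈ (stabDelta L W).subgroupOf (isomBox h), ∀ x : H, D.fSW Ψ (j p * x) = D.fSW Ψ x}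
    (P : GluePrintInputs D GU h j hP)
    (hloc : ∀ (i : Place (maximalRealSubfield L)) (v : Space 𝓔'),
      Continuous fun g : locTorus (maximalRealSubfield L) L i => D.ω (RestrictedProduct.mulSingle (genLevel L) i g) v)
    {T' : Finset (Place (maximalRealSubfield L))}
    (hχT' : RestrictedProduct.boxSubgroup (genLevel L) T' ≤ χ.ker)
    (hlocχ : ∀ i ∈ T', Continuous fun g : locTorus (maximalRealSubfield L) L i =>
      χ (RestrictedProduct.mulSingle (genLevel L) i g))
    {S : Finset (Place (maximalRealSubfield L))} (hT'S : T' ⊆ S)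
    (hS : ∀ v : InfinitePlace (maximalRealSubfield L), Sum.inl v ∈ S)
    {ν : ∀ i : Place (maximalRealSubfield L),
      ((basePlaceOf L i).adicCompletion (maximalRealSubfield L))ˣ →* Circle}
    (hν : ∀ i, i ∉ S → IsSplitPlace L i →
      ∀ u : ((basePlaceOf L i).adicCompletion (maximalRealSubfield L))ˣ,
        ‖(u : (basePlaceOf L i).adicCompletion (maximalRealSubfield L))‖ = 1 → ν i u = 1)
    (hνc : ∀ i, IsSplitPlace L i → Continuous (ν i))
    (x₀ : ∀ i : Place (maximalRealSubfield L), Fin 3 → (basePlaceOf L i).adicCompletion (maximalRealSubfield L))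
    (hx₀ : ∀ i ∈ S, IsSplitPlace L i → x₀ i ≠ 0)
    (V : ∀ i, LocH L i →ₗᵢ[ℂ] H' i) (hV : ∀ᶠ i in cofinite, V i ((unitFam L).e i) = 𝓔'.e i)
    (hint : ∀ (i : Place (maximalRealSubfield L)) (g : locTorus (maximalRealSubfield L) L i) (v : LocH L i),
      V i (locRep L χ ν i g v) = ρ' i g (V i v))
    (hω : D.ω = rep hρ') [IsFiniteMeasure GU.μ] :
    ∃ 𝓕 : Set (Model L), IsCompact 𝓕 ∧ (interior 𝓕).Nonempty ∧ MeasurableSet 𝓕 ∧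
      IsFundamentalDomain (unitaryToModel L).range 𝓕
        (haarDatum (genLevel L) (isCompact_genLevel L) (isOpen_genLevel L) S₀).μ ∧
      (haarDatum (genLevel L) (isCompact_genLevel L) (isOpen_genLevel L) S₀).μ 𝓕 ≠ 0 ∧
      (haarDatum (genLevel L) (isCompact_genLevel L) (isOpen_genLevel L) S₀).μ 𝓕 ≠ ⊤ ∧
      ∀ [IsFiniteMeasure (((haarDatum (genLevel L) (isCompact_genLevel L) (isOpen_genLevel L) S₀).μ).restrict 𝓕)]
        (hk : Measurable (Function.uncurry
          (thetaFn D GU (tmap V hV (phi L S x₀ (radius L S hνc hχT' hlocχ x₀ hx₀)))))) {Ck : ℝ} (hCk : 0 ≤ Ck)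
        (hkC : ∀ q u, ‖thetaFn D GU (tmap V hV (phi L S x₀ (radius L S hνc hχT' hlocχ x₀ hx₀))) q u‖ ≤ Ck),
        PeterssonFubini.theta GU.μ
          (((haarDatum (genLevel L) (isCompact_genLevel L) (isOpen_genLevel L) S₀).μ).restrict 𝓕) hk
          (measurable_coe_char (genLevel L) (isOpen_genLevel L) χ hχT' hlocχ) hCk hkC (norm_coe_char_le χ) ≠ 0 := by
  have hπ : ∀ (g : Model L) (x : RVec (unitFam L)),
      D.ω g (tp 𝓔' (mapVec V hV x)) = tp 𝓔' (mapVec V hV (gact (admissible L hν hχT') g x)) := by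
    rw [hω]; intro g x; rw [rep_tp, mapVec_gact (admissible L hν hχT') hρ' V hV hint]
  have h := exists_compactDomain_thetaLift_ne_zero_genuine_tensor_of_kernelMap L S₀ hW hh D GU j hj χ hχΓ hχVΓ P
    hloc hχT' hlocχ hT'S hS hν hνc x₀ hx₀ (fun x => tp 𝓔' (mapVec V hV x)) (kernel_tp_mapVec V hV) hπ
  beta_reduce at h
  rwa [← tmap_tp] at h


-- port_pkg: scope closed for this part
end HodgeCM.PerL34.RestrictedTensor.Genuine
end
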